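import Literature.Topology.FourManifolds.TrisectionsImplantFaces
import Literature.Topology.FourManifolds.TrisectionsStabilizationNF
import Literature.Topology.FourManifolds.TrisectionsSectorClauses
import Literature.Topology.FourManifolds.TrisectionsTriNormalForm
import Literature.Topology.FourManifolds.TrisectionsFaceFromGK
import HarnessLib

/-!
# Gay–Kirby's stabilisation of a trisection with corners (Lemma 10, geometric form)

Topic `Literature/Topology/FourManifolds`; infrastructure for the fact seat
`provefact-Literature.Topology.FourManifolds.exists-14560f9fc8` (named fact (c′)
`Literature.Topology.FourManifolds.exists_stabilized_gkTrisection`, Gay–Kirby 2016, Def. 8 and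
Lemma 10).  Everything in this file is **proved**; no definitions, no named facts.

**Theorem (`IsGKTrisection.exists_stabilization`).**  *Every `(g; k₁, k₂, k₃)`-trisection with
corners of a closed smooth `4`-manifold with nonempty central surface can be stabilised to a
`(g + 3; k₁ + 1, k₂ + 1, k₃ + 1)`-trisection* (Gay–Kirby 2016, Def. 8 and Lemma 10, over the
structure `IsGKTrisection`).  Put the trisection in normal form
(`IsGKTrisection.exists_triNormalForm`) together with its faces
(`IsGKTrisection.faceNormalForms`), perform three implants with the roles of the sectors
rotated (`TriNormalForm.exists_implantF`: each adds one index-`1` critical point to one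
sector and to each of the three faces), and recognise the result
(`isGKTrisection_of_triNormalForm`, `FaceNormalForm.face_clause`).

## References

* D. Gay, R. Kirby, *Trisecting 4-manifolds*, Geom. Topol. 20 (2016) 3097–3132, Def. 8 and
  Lemma 10. [GayKirby2016]
-/

open scoped Manifold ContDiff Topology
open Set Function Filter

noncomputable section

namespace Literature.Topology.FourManifolds

universe u

section Stabilization

variable {X : Type u} [TopologicalSpace X] [T2Space X] [CompactSpace X]
  [ChartedSpace (EuclideanSpace ℝ (Fin 4)) X] [IsManifold (𝓡 4) ∞ X]

/-- **Three implants with the faces** (`TriNormalForm.exists_implantF` three times, roles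
rotated): all sector counts and all face counts are raised by one at index `1`.
[cite: GayKirby2016, Def. 8 and Lemma 10] -/
theorem TriNormalForm.exists_stabilizationF {S : Fin 3 → Set X} {i j l : Fin 3} {u v : X → ℝ}
    {ρ : X → X} {U O : Set X} {c : Fin 3 → ℕ → ℕ} {f₁ f₂ f₃ : ℕ → ℕ}
    (hT : TriNormalForm S i j l u v ρ U O c)
    (hQ₁ : FaceNormalForm (S i ∩ S j) (⋂ m, S m) u v U f₁)
    (hQ₂ : FaceNormalForm (S j ∩ S l) (⋂ m, S m) (fun y => v y - u y) (fun y => -u y) U f₂)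
    (hQ₃ : FaceNormalForm (S l ∩ S i) (⋂ m, S m) (fun y => -v y) (fun y => u y - v y) U f₃)
    (hne : (⋂ m, S m).Nonempty) :
    ∃ (S' : Fin 3 → Set X) (u' v' : X → ℝ) (ρ' : X → X) (O' : Set X),
      TriNormalForm S' i j l u' v' ρ' U O' (fun m n => c m n + if n = 1 then 1 else 0) ∧
      FaceNormalForm (S' i ∩ S' j) (⋂ m, S' m) u' v' U (fun n => f₁ n + if n = 1 then 3 else 0) ∧
      FaceNormalForm (S' j ∩ S' l) (⋂ m, S' m) (fun y => v' y - u' y) (fun y => -u' y) U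
        (fun n => f₂ n + if n = 1 then 3 else 0) ∧
      FaceNormalForm (S' l ∩ S' i) (⋂ m, S' m) (fun y => -v' y) (fun y => u' y - v' y) U
        (fun n => f₃ n + if n = 1 then 3 else 0) ∧
      (⋂ m, S' m).Nonempty := by
  -- the bundled configuration and its rotation
  have rotate : ∀ {S₀ : Fin 3 → Set X} {i₀ j₀ l₀ : Fin 3} {u₀ v₀ : X → ℝ} {ρ₀ : X → X} {O₀ : Set X}
      {c₀ : Fin 3 → ℕ → ℕ} {g₁ g₂ g₃ : ℕ → ℕ},
      TriNormalForm S₀ i₀ j₀ l₀ u₀ v₀ ρ₀ U O₀ c₀ →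
      FaceNormalForm (S₀ i₀ ∩ S₀ j₀) (⋂ m, S₀ m) u₀ v₀ U g₁ →
      FaceNormalForm (S₀ j₀ ∩ S₀ l₀) (⋂ m, S₀ m) (fun y => v₀ y - u₀ y) (fun y => -u₀ y) U g₂ →
      FaceNormalForm (S₀ l₀ ∩ S₀ i₀) (⋂ m, S₀ m) (fun y => -v₀ y) (fun y => u₀ y - v₀ y) U g₃ →
      TriNormalForm S₀ j₀ l₀ i₀ (fun y => v₀ y - u₀ y) (fun y => -u₀ y) ρ₀ U O₀ c₀ ∧
      FaceNormalForm (S₀ j₀ ∩ S₀ l₀) (⋂ m, S₀ m) (fun y => v₀ y - u₀ y) (fun y => -u₀ y) U g₂ ∧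
      FaceNormalForm (S₀ l₀ ∩ S₀ i₀) (⋂ m, S₀ m)
        (fun y => (fun y => -u₀ y) y - (fun y => v₀ y - u₀ y) y) (fun y => -(fun y => v₀ y - u₀ y) y) U g₃ ∧
      FaceNormalForm (S₀ i₀ ∩ S₀ j₀) (⋂ m, S₀ m)
        (fun y => -(fun y => -u₀ y) y) (fun y => (fun y => v₀ y - u₀ y) y - (fun y => -u₀ y) y) U g₁ := by
    intro S₀ i₀ j₀ l₀ u₀ v₀ ρ₀ O₀ c₀ g₁ g₂ g₃ hT₀ h₁ h₂ h₃
    refine ⟨hT₀.rotate, h₂, ?_, ?_⟩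
    · have e1 : (fun y => (fun y => -u₀ y) y - (fun y => v₀ y - u₀ y) y) = fun y => -v₀ y := funext fun y => by ring
      have e2 : (fun y => -(fun y => v₀ y - u₀ y) y) = fun y => u₀ y - v₀ y := funext fun y => by ring
      rw [e1, e2]; exact h₃
    · have e3 : (fun y => -(fun y => -u₀ y) y) = u₀ := funext fun y => by ring
      have e4 : (fun y => (fun y => v₀ y - u₀ y) y - (fun y => -u₀ y) y) = v₀ := funext fun y => by ring
      rw [e3, e4]; exact h₁
  -- one implant with faces and a prescribed surviving point
  have step : ∀ {S₀ : Fin 3 → Set X} {i₀ j₀ l₀ : Fin 3} {u₀ v₀ : X → ℝ} {ρ₀ : X → X} {O₀ : Set X}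
      {c₀ : Fin 3 → ℕ → ℕ} {g₁ g₂ g₃ : ℕ → ℕ},
      TriNormalForm S₀ i₀ j₀ l₀ u₀ v₀ ρ₀ U O₀ c₀ →
      FaceNormalForm (S₀ i₀ ∩ S₀ j₀) (⋂ m, S₀ m) u₀ v₀ U g₁ →
      FaceNormalForm (S₀ j₀ ∩ S₀ l₀) (⋂ m, S₀ m) (fun y => v₀ y - u₀ y) (fun y => -u₀ y) U g₂ →
      FaceNormalForm (S₀ l₀ ∩ S₀ i₀) (⋂ m, S₀ m) (fun y => -v₀ y) (fun y => u₀ y - v₀ y) U g₃ →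
      (⋂ m, S₀ m).Nonempty →
      ∃ (S₁ : Fin 3 → Set X) (u₁ v₁ : X → ℝ) (ρ₁ : X → X) (O₁ : Set X),
        TriNormalForm S₁ i₀ j₀ l₀ u₁ v₁ ρ₁ U O₁
          (Function.update c₀ i₀ (fun n => c₀ i₀ n + if n = 1 then 1 else 0)) ∧
        FaceNormalForm (S₁ i₀ ∩ S₁ j₀) (⋂ m, S₁ m) u₁ v₁ U (fun n => g₁ n + if n = 1 then 1 else 0) ∧
        FaceNormalForm (S₁ j₀ ∩ S₁ l₀) (⋂ m, S₁ m) (fun y => v₁ y - u₁ y) (fun y => -u₁ y) U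
          (fun n => g₂ n + if n = 1 then 1 else 0) ∧
        FaceNormalForm (S₁ l₀ ∩ S₁ i₀) (⋂ m, S₁ m) (fun y => -v₁ y) (fun y => u₁ y - v₁ y) U
          (fun n => g₃ n + if n = 1 then 1 else 0) ∧
        (⋂ m, S₁ m).Nonempty := by
    intro S₀ i₀ j₀ l₀ u₀ v₀ ρ₀ O₀ c₀ g₁ g₂ g₃ hT₀ h₁ h₂ h₃ hne₀
    obtain ⟨x, hx⟩ := hne₀
    obtain ⟨x₁, hx₁, hx₁x⟩ := hT₀.sector_i.exists_ne_mem hx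
    obtain ⟨S₁, u₁, v₁, ρ₁, O₁, hT₁, hSagree, -, hF₁, hF₂, hF₃⟩ :=
      hT₀.exists_implantF h₁ h₂ h₃ hx (isClosed_singleton (x := x₁)).isOpen_compl (fun h => hx₁x h.symm)
    refine ⟨S₁, u₁, v₁, ρ₁, O₁, hT₁, hF₁, hF₂, hF₃, ⟨x₁, mem_iInter.2 fun m => ?_⟩⟩
    exact (hSagree m x₁ (fun h => h rfl)).2 (mem_iInter.1 hx₁ m)
  -- three implants with the roles rotated
  obtain ⟨S₁, u₁, v₁, ρ₁, O₁, hT₁, hA₁, hB₁, hC₁, hne₁⟩ := step hT hQ₁ hQ₂ hQ₃ hne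
  obtain ⟨hT₁', hA₁', hB₁', hC₁'⟩ := rotate hT₁ hA₁ hB₁ hC₁
  obtain ⟨S₂, u₂, v₂, ρ₂, O₂, hT₂, hA₂, hB₂, hC₂, hne₂⟩ := step hT₁' hA₁' hB₁' hC₁' hne₁
  obtain ⟨hT₂', hA₂', hB₂', hC₂'⟩ := rotate hT₂ hA₂ hB₂ hC₂
  obtain ⟨S₃, u₃, v₃, ρ₃, O₃, hT₃, hA₃, hB₃, hC₃, hne₃⟩ := step hT₂' hA₂' hB₂' hC₂' hne₂
  obtain ⟨hT₄, hA₄, hB₄, hC₄⟩ := rotate hT₃ hA₃ hB₃ hC₃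
  refine ⟨S₃, fun y => v₃ y - u₃ y, fun y => -u₃ y, ρ₃, O₃, ?_, ?_, ?_, ?_, hne₃⟩
  · have hij := hT.ne_ij
    have hjl := hT.ne_jl
    have hil := hT.ne_il
    have hc : Function.update (Function.update (Function.update c i fun n => c i n + if n = 1 then 1 else 0) j
          fun n => Function.update c i (fun n => c i n + if n = 1 then 1 else 0) j n + if n = 1 then 1 else 0) l
        (fun n => Function.update (Function.update c i fun n => c i n + if n = 1 then 1 else 0) j
          (fun n => Function.update c i (fun n => c i n + if n = 1 then 1 else 0) j n + if n = 1 then 1 else 0) l n +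
          if n = 1 then 1 else 0) = fun m n => c m n + if n = 1 then 1 else 0 := by
      funext m n
      rcases hT.eq_or m with rfl | rfl | rfl
      · rw [Function.update_of_ne hil, Function.update_of_ne hij, Function.update_self]
      · rw [Function.update_of_ne hjl, Function.update_self, Function.update_of_ne (Ne.symm hij)]
      · rw [Function.update_self, Function.update_of_ne (Ne.symm hjl), Function.update_of_ne (Ne.symm hil)]
    rw [hc] at hT₄
    exact hT₄
  · have : (fun n => (f₁ n + if n = 1 then 1 else 0) + (if n = 1 then 1 else 0) + if n = 1 then 1 else 0) =
        fun n => f₁ n + if n = 1 then 3 else 0 := by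
      funext n; split_ifs <;> omega
    rw [← this]; exact hA₄
  · have : (fun n => (f₂ n + if n = 1 then 1 else 0) + (if n = 1 then 1 else 0) + if n = 1 then 1 else 0) =
        fun n => f₂ n + if n = 1 then 3 else 0 := by
      funext n; split_ifs <;> omega
    rw [← this]; exact hB₄
  · have : (fun n => (f₃ n + if n = 1 then 1 else 0) + (if n = 1 then 1 else 0) + if n = 1 then 1 else 0) =
        fun n => f₃ n + if n = 1 then 3 else 0 := by
      funext n; split_ifs <;> omega
    rw [← this]; exact hC₄

/-- **Gay–Kirby 2016, Lemma 10 (geometric form): stabilising a trisection with corners.**  See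
the module docstring. [cite: GayKirby2016, Def. 8 and Lemma 10] -/
theorem IsGKTrisection.exists_stabilization {g : ℕ} {k : Fin 3 → ℕ} {S : Fin 3 → Set X}
    (h : IsGKTrisection X g k S) (hne : (⋂ m, S m).Nonempty) :
    ∃ S' : Fin 3 → Set X, IsGKTrisection X (g + 3) (fun m => k m + 1) S' ∧ (⋂ m, S' m).Nonempty := by
  -- normal form with faces
  obtain ⟨u, v, U, O, ρ, hT⟩ := h.exists_triNormalForm (i := 0) (j := 1) (l := 2) (by decide) (by decide) (by decide)
  obtain ⟨hQ₁, hQ₂, hQ₃⟩ := h.faceNormalForms hT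
  -- three implants
  obtain ⟨S', u', v', ρ', O', hT', hF₁, hF₂, hF₃, hne'⟩ := hT.exists_stabilizationF hQ₁ hQ₂ hQ₃ hne
  -- the counts
  have hcnt : (fun m n => handleCount 1 (k m) n + if n = 1 then 1 else 0) = fun m => handleCount 1 (k m + 1) := by
    funext m; exact handleCount_add_indicator_one (k m)
  rw [hcnt] at hT'
  have hg : ∀ f : ℕ → ℕ, f = handleCount 1 g → (fun n => f n + if n = 1 then 3 else 0) = handleCount 1 (g + 3) := by
    rintro f rfl
    funext n
    unfold handleCount
    rcases n with _ | _ | n <;> simp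
  rw [hg _ rfl] at hF₁ hF₂ hF₃
  refine ⟨S', isGKTrisection_of_triNormalForm hT' fun a b hab => ?_, hne'⟩
  -- the face clause for all ordered pairs
  have key : ∀ {a b : Fin 3} {nrm col : X → ℝ}, FaceNormalForm (S' a ∩ S' b) (⋂ m, S' m) nrm col U (handleCount 1 (g + 3)) →
      ∀ a' b', S' a' ∩ S' b' = S' a ∩ S' b →
      ∃ (H : Type u) (_ : TopologicalSpace H) (_ : ChartedSpace (EuclideanHalfSpace 3) H) (h : H → X),
        IsManifold (𝓡∂ 3) ∞ H ∧ CompactSpace H ∧ ConnectedSpace H ∧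
          HasHandleDecomposition 2 H (handleCount 1 (g + 3)) ∧
          Manifold.IsSmoothEmbedding (𝓡∂ 3) (𝓡 4) ∞ h ∧ range h = S' a' ∩ S' b' ∧
          h '' (𝓡∂ 3).boundary H = ⋂ m, S' m := by
    intro a b nrm col hQ a' b' heq
    obtain ⟨H, _, _, hmap, hM, hc, hconn, hHD, hemb, hrange, hbd⟩ := hQ.face_clause
    exact ⟨H, _, _, hmap, hM, hc, hconn, hHD, hemb, by rw [heq]; exact hrange, hbd⟩
  have h01 : (0 : Fin 3) ≠ 1 := by decide
  have h12 : (1 : Fin 3) ≠ 2 := by decide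
  have h02 : (0 : Fin 3) ≠ 2 := by decide
  fin_cases a <;> fin_cases b
  · exact absurd rfl hab
  · exact key hF₁ _ _ rfl
  · exact key hF₃ _ _ (inter_comm _ _)
  · exact key hF₁ _ _ (inter_comm _ _)
  · exact absurd rfl hab
  · exact key hF₂ _ _ rfl
  · exact key hF₃ _ _ rfl
  · exact key hF₂ _ _ (inter_comm _ _)
  · exact absurd rfl hab

end Stabilization

end Literature.Topology.FourManifolds
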